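import Mathlib
import Summits.ValiantsHypothesis.ValiantsHypothesis.Theorems.LiouvilleSarnakAlignedTypeICharactersMod2nCharacterFree
import HarnessLib

/-!
# Route LiouvilleSarnak — support `AlignedTypeI` (stmt-ValiantsHypothesis-21040), line `characters_mod_2n`:
# the registered stub `KMTVariance` is EQUIVALENT to the crux

Companion of `…CharactersMod2nOneStub.lean` (the second registered stub follows from the first) and
`…CharactersMod2nCharacterFree.lean` (the first stub `KMTVariance` ⟺ `ℓ¹`-equidistribution of `λ` over the odd
classes mod `2^k` along `b < 2^n`, `U(n,k) := Σ_{u ∈ (ℤ/2^k)ˣ} |Σ_{b<2^n} λ(u + 2^k b)| ≤ ε 2^(n+k)`, at ALL levels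
`k₀ ≤ k ≤ n`), closing the structural analysis of the registered line
`Cruxes/AlignedTypeI/Lines/characters_mod_2n.lean`:

* §1 **Refinement monotonicity.**  Splitting `b < 2^(n+1)` by parity,
  `A_{n+1,k}(u) = A_{n,k+1}(u) + A_{n,k+1}(u + 2^k)` (`classSum_succ_eq`), hence `U(n+1, k) ≤ U(n, k+1)` for `k ≥ 1`
  (`unitAbsSum_succ_le`) and `U(n+t, k) ≤ U(n, k+t)` (`unitAbsSum_add_le`): at fixed `x = 2^(n+k)` the `ℓ¹`
  deviation only GROWS when the modulus is refined, so every level is dominated by the finest admissible one,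
  `n - k ∈ {0, 1}` — a TOP level in the sense of `…TopLevels.lean`.
* §2 Consequently the all-levels statement follows from the two top-level statements `j = 0, 1` of
  `alignedTypeI_iff_topLevels` (`unitAbsSum_of_topTwoLevels`), and

  `kmtVariance_iff_alignedTypeI : KMTVariance ↔ AlignedTypeI`

  (`→` is `alignedTypeI_of_KMTVariance` of `…KMTOnly.lean`; `←` is new).  So the line's one stub of content,
  `stub_kmtVariance`, is a RESTATEMENT of the crux (Klurman–Mangerel–Teräväinen's variance for `λ` to moduli `2^k`,
  `k₀ ≤ k ≤ n`, progressions of length `2^n` ⟺ the aligned type-I `ℓ¹` statement at `q = 2^n = √x`): closing it by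
  name is exactly as hard as the crux, and the line `characters_mod_2n` has no proper sub-structure — its only
  non-circular content is the cite-grade implication `KMT2023_theorem13_liouville_twoPower → AlignedTypeI`
  (`alignedTypeI_of_KMT13`).  By-products: `alignedTypeI_iff_topTwoLevels` (the crux ⟺ its top TWO levels only,
  sharpening `alignedTypeI_iff_topLevels`) and `twistedLiouvilleSmall_of_alignedTypeI` (the crux implies that `λ`
  does not correlate with ANY Dirichlet character to a modulus `2^k ≤ √x`: `AlignedTypeI → TwistedLiouvilleSmall`;
  the converse is the direction that fails — a sup bound over characters does not give the `ℓ¹` statement).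

HONEST FRAMING.  Pure bookkeeping between the line's registered propositions; nothing cite-grade is discharged, no
stub is closed by name, `AlignedTypeI` is NOT closed (its residual is unchanged: KMT 2023 Thm 1.3 for `λ` and
`2`-power moduli `≍ √x`, named fact, no `_holds`), and nothing here bears on `VP ≠ VNP` (NOT proved).
-/

set_option linter.dupNamespace false

noncomputable section

namespace Summit.ValiantsHypothesis.ValiantsHypothesis.Theorems.LiouvilleSarnak.AlignedTypeI.CharactersModTwoN

open ArithmeticFunction Finset
open scoped BigOperators

/-! ## §1 Refinement monotonicity of the `ℓ¹` deviation -/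

/-- `Σ_{b < 2M} f(b) = Σ_{b < M} (f(2b) + f(2b+1))`. [folklore] -/
theorem sum_range_two_mul_eq (f : ℕ → ℤ) (M : ℕ) :
    ∑ b ∈ Finset.range (2 * M), f b = ∑ b ∈ Finset.range M, (f (2 * b) + f (2 * b + 1)) := by
  induction M with
  | zero => simp
  | succ M ih =>
    rw [show 2 * (M + 1) = 2 * M + 1 + 1 by ring, Finset.sum_range_succ, Finset.sum_range_succ, ih,
      Finset.sum_range_succ]
    ring

/-- **Parity split of a class sum**: `A_{n+1,k}(u) = A_{n,k+1}(u) + A_{n,k+1}(u + 2^k)`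
(`u + 2^k (2b' + r) = (u + r 2^k) + 2^(k+1) b'`). [folklore] -/
theorem classSum_succ_eq (n k u : ℕ) :
    classSum (n + 1) k u = classSum n (k + 1) u + classSum n (k + 1) (u + 2 ^ k) := by
  unfold classSum
  rw [Fin.sum_univ_eq_sum_range (fun b => liouville (u + 2 ^ k * b)) (2 ^ (n + 1)),
    Fin.sum_univ_eq_sum_range (fun b => liouville (u + 2 ^ (k + 1) * b)) (2 ^ n),
    Fin.sum_univ_eq_sum_range (fun b => liouville (u + 2 ^ k + 2 ^ (k + 1) * b)) (2 ^ n),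
    pow_succ, mul_comm (2 ^ n) 2, sum_range_two_mul_eq, Finset.sum_add_distrib]
  congr 1
  · refine Finset.sum_congr rfl fun b _ => ?_
    congr 1
    rw [pow_succ]
    ring
  · refine Finset.sum_congr rfl fun b _ => ?_
    congr 1
    rw [pow_succ]
    ring

/-- **Refinement monotonicity**: `U(n+1, k) ≤ U(n, k+1)` for `k ≥ 1` — refining the modulus from `2^k` to `2^(k+1)`
at fixed `x = 2^(n+k+1)` can only increase the `ℓ¹` deviation (triangle inequality on the parity split; the two lifts
`u`, `u + 2^k` of an odd class `u (mod 2^k)` are distinct odd classes mod `2^(k+1)`). [folklore] -/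
theorem unitAbsSum_succ_le {n k : ℕ} (hk : 1 ≤ k) :
    ∑ u : (ZMod (2 ^ k))ˣ,
        |∑ b : Fin (2 ^ (n + 1)), ((liouville ((u : ZMod (2 ^ k)).val + 2 ^ k * (b : ℕ)) : ℤ) : ℝ)| ≤
      ∑ u : (ZMod (2 ^ (k + 1)))ˣ,
        |∑ b : Fin (2 ^ n), ((liouville ((u : ZMod (2 ^ (k + 1))).val + 2 ^ (k + 1) * (b : ℕ)) : ℤ) : ℝ)| := by
  haveI : NeZero (2 ^ k) := ⟨pow_ne_zero _ two_ne_zero⟩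
  haveI : NeZero (2 ^ (k + 1)) := ⟨pow_ne_zero _ two_ne_zero⟩
  simp_rw [classSum_cast_eq]
  have hK2 : 2 ^ (k + 1) = 2 ^ k + 2 ^ k := by rw [pow_succ]; ring
  have hKeven : Even (2 ^ k) := ⟨2 ^ (k - 1), by rw [← two_mul, ← pow_succ', Nat.sub_add_cancel hk]⟩
  -- odd classes lift to odd classes
  have hodd : ∀ u : (ZMod (2 ^ k))ˣ, Odd (u : ZMod (2 ^ k)).val := by
    intro u
    have h := ZMod.val_coe_unit_coprime u
    rw [Nat.coprime_pow_right_iff hk, Nat.coprime_two_right] at h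
    exact h
  have hcop : ∀ p : (ZMod (2 ^ k))ˣ × Fin 2,
      Nat.Coprime ((p.1 : ZMod (2 ^ k)).val + (p.2 : ℕ) * 2 ^ k) (2 ^ (k + 1)) := fun p =>
    (Nat.coprime_two_right.mpr ((hodd p.1).add_even (hKeven.mul_left _))).pow_right (k + 1)
  have hlt : ∀ p : (ZMod (2 ^ k))ˣ × Fin 2, (p.1 : ZMod (2 ^ k)).val + (p.2 : ℕ) * 2 ^ k < 2 ^ (k + 1) := by
    intro p
    have h1 : (p.1 : ZMod (2 ^ k)).val < 2 ^ k := ZMod.val_lt _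
    have h2 : (p.2 : ℕ) ≤ 1 := Nat.lt_succ_iff.mp p.2.isLt
    have h3 : (p.2 : ℕ) * 2 ^ k ≤ 1 * 2 ^ k := Nat.mul_le_mul_right (2 ^ k) h2
    omega
  -- the lift map and its injectivity
  set g : (ZMod (2 ^ k))ˣ × Fin 2 → (ZMod (2 ^ (k + 1)))ˣ :=
    fun p => ZMod.unitOfCoprime _ (hcop p) with hg
  have hval : ∀ p : (ZMod (2 ^ k))ˣ × Fin 2,
      ((g p : (ZMod (2 ^ (k + 1)))ˣ) : ZMod (2 ^ (k + 1))).val = (p.1 : ZMod (2 ^ k)).val + (p.2 : ℕ) * 2 ^ k := by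
    intro p
    show ((ZMod.unitOfCoprime _ (hcop p) : (ZMod (2 ^ (k + 1)))ˣ) : ZMod (2 ^ (k + 1))).val = _
    rw [ZMod.coe_unitOfCoprime, ZMod.val_natCast, Nat.mod_eq_of_lt (hlt p)]
  have hinj : Function.Injective g := by
    intro p q hpq
    have hv : (p.1 : ZMod (2 ^ k)).val + (p.2 : ℕ) * 2 ^ k = (q.1 : ZMod (2 ^ k)).val + (q.2 : ℕ) * 2 ^ k := by
      rw [← hval p, ← hval q, hpq]
    have hu : (p.1 : ZMod (2 ^ k)).val < 2 ^ k := ZMod.val_lt _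
    have hu' : (q.1 : ZMod (2 ^ k)).val < 2 ^ k := ZMod.val_lt _
    have hr : (p.2 : ℕ) ≤ 1 := Nat.lt_succ_iff.mp p.2.isLt
    have hr' : (q.2 : ℕ) ≤ 1 := Nat.lt_succ_iff.mp q.2.isLt
    have h2 : (p.2 : ℕ) = (q.2 : ℕ) := by
      rcases Nat.le_one_iff_eq_zero_or_eq_one.mp hr with h | h <;>
        rcases Nat.le_one_iff_eq_zero_or_eq_one.mp hr' with h' | h' <;>
          simp only [h, h', zero_mul, one_mul, add_zero] at hv ⊢ <;> omega
    have h1 : (p.1 : ZMod (2 ^ k)).val = (q.1 : ZMod (2 ^ k)).val := by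
      rw [h2] at hv
      omega
    exact Prod.ext (Units.ext (ZMod.val_injective _ h1)) (Fin.ext h2)
  -- assemble
  calc ∑ u : (ZMod (2 ^ k))ˣ, |((classSum (n + 1) k (u : ZMod (2 ^ k)).val : ℤ) : ℝ)|
      ≤ ∑ u : (ZMod (2 ^ k))ˣ, (|((classSum n (k + 1) (u : ZMod (2 ^ k)).val : ℤ) : ℝ)| +
          |((classSum n (k + 1) ((u : ZMod (2 ^ k)).val + 2 ^ k) : ℤ) : ℝ)|) := by
        refine Finset.sum_le_sum fun u _ => ?_
        rw [classSum_succ_eq, Int.cast_add]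
        exact abs_add_le _ _
    _ = ∑ p : (ZMod (2 ^ k))ˣ × Fin 2,
          |((classSum n (k + 1) ((p.1 : ZMod (2 ^ k)).val + (p.2 : ℕ) * 2 ^ k) : ℤ) : ℝ)| := by
        rw [Fintype.sum_prod_type]
        refine Finset.sum_congr rfl fun u _ => ?_
        rw [Fin.sum_univ_two]
        simp only [Fin.val_zero, Fin.val_one, zero_mul, add_zero, one_mul]
    _ = ∑ p : (ZMod (2 ^ k))ˣ × Fin 2,
          |((classSum n (k + 1) ((g p : (ZMod (2 ^ (k + 1)))ˣ) : ZMod (2 ^ (k + 1))).val : ℤ) : ℝ)| := by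
        simp_rw [hval]
    _ = ∑ u ∈ (Finset.univ : Finset ((ZMod (2 ^ k))ˣ × Fin 2)).map ⟨g, hinj⟩,
          |((classSum n (k + 1) (u : ZMod (2 ^ (k + 1))).val : ℤ) : ℝ)| := by
        rw [Finset.sum_map]
        rfl
    _ ≤ ∑ u : (ZMod (2 ^ (k + 1)))ˣ, |((classSum n (k + 1) (u : ZMod (2 ^ (k + 1))).val : ℤ) : ℝ)| :=
        Finset.sum_le_sum_of_subset_of_nonneg (Finset.subset_univ _) fun _ _ _ => abs_nonneg _

/-- Iterated refinement monotonicity: `U(n+t, k) ≤ U(n, k+t)` for `k ≥ 1` — at fixed `x = 2^(n+k+t)` every level is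
dominated by any finer one. [folklore] -/
theorem unitAbsSum_add_le (t : ℕ) :
    ∀ {n k : ℕ}, 1 ≤ k →
      ∑ u : (ZMod (2 ^ k))ˣ,
          |∑ b : Fin (2 ^ (n + t)), ((liouville ((u : ZMod (2 ^ k)).val + 2 ^ k * (b : ℕ)) : ℤ) : ℝ)| ≤
        ∑ u : (ZMod (2 ^ (k + t)))ˣ,
          |∑ b : Fin (2 ^ n), ((liouville ((u : ZMod (2 ^ (k + t))).val + 2 ^ (k + t) * (b : ℕ)) : ℤ) : ℝ)| := by
  induction t with
  | zero => intro n k _; exact le_rfl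
  | succ t ih =>
    intro n k hk
    have h1 := unitAbsSum_succ_le (n := n + t) (k := k) hk
    have h2 := @ih n (k + 1) (by omega)
    rw [show k + 1 + t = k + (t + 1) by omega] at h2
    exact h1.trans h2

/-! ## §2 All levels from the top two levels; the stub is the crux -/

/-- **All levels from the top two levels.**  If the `ℓ¹` deviation is `o(4^n)` at co-depth `j = 0` (`k = n`) and
`j = 1` (`k = n - 1`) — the two top-level statements of `alignedTypeI_iff_topLevels` — then it is `≤ ε 2^(n+k)` at ALL
levels `1 ≤ k ≤ n` (`n ≥ n₀`): write `n - k = 2t + j` and climb `t` levels by `unitAbsSum_add_le`. [folklore] -/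
theorem unitAbsSum_of_topTwoLevels
    (h0 : ∀ ε : ℝ, 0 < ε → ∃ n₀ : ℕ, ∀ n k : ℕ, n₀ ≤ n → n = k + 0 → 1 ≤ k →
      ∑ u : (ZMod (2 ^ k))ˣ,
        |∑ b : Fin (2 ^ n), ((liouville ((u : ZMod (2 ^ k)).val + 2 ^ k * (b : ℕ)) : ℤ) : ℝ)| ≤ ε * 4 ^ n)
    (h1 : ∀ ε : ℝ, 0 < ε → ∃ n₀ : ℕ, ∀ n k : ℕ, n₀ ≤ n → n = k + 1 → 1 ≤ k →
      ∑ u : (ZMod (2 ^ k))ˣ,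
        |∑ b : Fin (2 ^ n), ((liouville ((u : ZMod (2 ^ k)).val + 2 ^ k * (b : ℕ)) : ℤ) : ℝ)| ≤ ε * 4 ^ n) :
    ∀ ε : ℝ, 0 < ε → ∃ k₀ n₀ : ℕ, ∀ n ≥ n₀, ∀ k : ℕ, k₀ ≤ k → k ≤ n →
      ∑ u : (ZMod (2 ^ k))ˣ,
        |∑ b : Fin (2 ^ n), ((liouville ((u : ZMod (2 ^ k)).val + 2 ^ k * (b : ℕ)) : ℤ) : ℝ)|
          ≤ ε * 2 ^ (n + k) := by
  intro ε hε
  obtain ⟨N₀, hN₀⟩ := h0 ε hε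
  obtain ⟨N₁, hN₁⟩ := h1 (ε / 2) (by positivity)
  refine ⟨1, 2 * (N₀ + N₁), fun n hn k hk hkn => ?_⟩
  obtain ⟨d, rfl⟩ := Nat.exists_eq_add_of_le hkn
  obtain ⟨t, ht | ht⟩ := Nat.even_or_odd' d
  · -- `d = 2t`: land on the level `j = 0` at depth `k + t`
    subst ht
    have e : k + 2 * t = k + t + t := by ring
    rw [e]
    refine (unitAbsSum_add_le t (n := k + t) (k := k) hk).trans ?_
    refine (hN₀ (k + t) (k + t) (by omega) rfl (by omega)).trans (le_of_eq ?_)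
    rw [show (4 : ℝ) ^ (k + t) = 2 ^ (k + t + t + k) by
      rw [show (4 : ℝ) = 2 ^ 2 by norm_num, ← pow_mul]; congr 1; ring]
  · -- `d = 2t + 1`: land on the level `j = 1` at depth `k + t + 1`
    subst ht
    have e : k + (2 * t + 1) = k + t + 1 + t := by ring
    rw [e]
    refine (unitAbsSum_add_le t (n := k + t + 1) (k := k) hk).trans ?_
    refine (hN₁ (k + t + 1) (k + t) (by omega) rfl (by omega)).trans (le_of_eq ?_)
    rw [show (4 : ℝ) ^ (k + t + 1) = 2 * 2 ^ (k + t + 1 + t + k) by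
      rw [show (4 : ℝ) = 2 ^ 2 by norm_num, ← pow_mul, ← pow_succ']; congr 1; ring]
    ring

/-- **The crux implies the stub**: `AlignedTypeI → KMTVariance` (top two levels by `alignedTypeI_iff_topLevels`, all
levels by `unitAbsSum_of_topTwoLevels`, the stub by `kmtVariance_iff_unitAbsSum`). [folklore] -/
theorem kmtVariance_of_alignedTypeI
    (hA : Summit.ValiantsHypothesis.ValiantsHypothesis.Theses.LiouvilleSarnak.AlignedTypeI) : KMTVariance :=
  kmtVariance_iff_unitAbsSum.mpr
    (unitAbsSum_of_topTwoLevels (alignedTypeI_iff_topLevels.mp hA 0) (alignedTypeI_iff_topLevels.mp hA 1))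

/-- **The registered stub `KMTVariance` is EQUIVALENT to the crux `AlignedTypeI`.**  (`→`:
`alignedTypeI_of_KMTVariance`, `…KMTOnly.lean`; `←`: `kmtVariance_of_alignedTypeI`.)  The line `characters_mod_2n`
therefore restates the crux; its one non-circular content is the cite-grade implication `alignedTypeI_of_KMT13`.
[folklore] -/
theorem kmtVariance_iff_alignedTypeI :
    KMTVariance ↔ Summit.ValiantsHypothesis.ValiantsHypothesis.Theses.LiouvilleSarnak.AlignedTypeI :=
  ⟨alignedTypeI_of_KMTVariance, kmtVariance_of_alignedTypeI⟩

/-- **The crux is its top two levels**: `AlignedTypeI` ⟺ the `ℓ¹` deviation is `o(4^n)` at co-depths `j = 0` and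
`j = 1` only (sharpening `alignedTypeI_iff_topLevels`, which asks every fixed `j`). [folklore] -/
theorem alignedTypeI_iff_topTwoLevels :
    Summit.ValiantsHypothesis.ValiantsHypothesis.Theses.LiouvilleSarnak.AlignedTypeI ↔
      ((∀ ε : ℝ, 0 < ε → ∃ n₀ : ℕ, ∀ n k : ℕ, n₀ ≤ n → n = k + 0 → 1 ≤ k →
        ∑ u : (ZMod (2 ^ k))ˣ,
          |∑ b : Fin (2 ^ n), ((liouville ((u : ZMod (2 ^ k)).val + 2 ^ k * (b : ℕ)) : ℤ) : ℝ)| ≤ ε * 4 ^ n) ∧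
      (∀ ε : ℝ, 0 < ε → ∃ n₀ : ℕ, ∀ n k : ℕ, n₀ ≤ n → n = k + 1 → 1 ≤ k →
        ∑ u : (ZMod (2 ^ k))ˣ,
          |∑ b : Fin (2 ^ n), ((liouville ((u : ZMod (2 ^ k)).val + 2 ^ k * (b : ℕ)) : ℤ) : ℝ)| ≤ ε * 4 ^ n)) :=
  ⟨fun hA => ⟨alignedTypeI_iff_topLevels.mp hA 0, alignedTypeI_iff_topLevels.mp hA 1⟩,
    fun h => alignedTypeI_of_unitAbsSum (unitAbsSum_of_topTwoLevels h.1 h.2)⟩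

/-- **The crux implies the second stub**: `AlignedTypeI → TwistedLiouvilleSmall` — the aligned type-I `ℓ¹` statement
forces `|Σ_{m ≤ 2^(n+k)} λ(m) χ(m)| ≤ ε 2^(n+k)` for EVERY character `χ` mod `2^k`, `k ≤ n` (no character to a modulus
`2^k ≤ √x` correlates with `λ`).  The converse direction is the one that fails. [folklore] -/
theorem twistedLiouvilleSmall_of_alignedTypeI
    (hA : Summit.ValiantsHypothesis.ValiantsHypothesis.Theses.LiouvilleSarnak.AlignedTypeI) :
    TwistedLiouvilleSmall :=
  twistedLiouvilleSmall_of_kmtVariance (kmtVariance_of_alignedTypeI hA)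

end Summit.ValiantsHypothesis.ValiantsHypothesis.Theorems.LiouvilleSarnak.AlignedTypeI.CharactersModTwoN
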